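import Summits.ValiantsHypothesis.ValiantsHypothesis.Theorems.DefinabilityGapPivotColumn
import Summits.ValiantsHypothesis.ValiantsHypothesis.Theorems.DefinabilityGapPivotPhaseA
import HarnessLib

/-!
# Definability gap, ROAD P: few BLOCKED rows per curve (N1 v2 §(5), the re-pick room)

In the alteration (PLAN-N1-v2 §(5)) a mover `c` re-picks its pivot row among the admissible
rows at which the pivot column `s₀` is FREE, i.e. outside `blockedRows T c r s₀`
(`DefinabilityGapPivotColumn`).  Deterministically `#blockedRows ≤ colLoad T c s₀`, which may
exceed `m`; under a product law with marginals `≤ p` the blocked rows are few: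

* `card_blockedRows_le_sum_colKill` — dictionary: `#blockedRows T c r s₀ ≤ Σ_{c'} colKill T c
  s₀ c' (r c')` (a blocked row has a killer pivoting in it; `colKill` of `PivotRandom` with
  `j = s₀`);
* **`weight_manyBlocked_le`** — Bernstein: if `colLoad T c s₀ ≤ Λ₀` then
  `W{p Λ₀ + t ≤ #blockedRows} ≤ exp(−t²/(2(p Λ₀ + t/3)))`;
* **`weight_exists_manyBlocked_le`** — union over the curves of `T` with `colLoad ≤ Λ₀`
  (the non-hubs): weight `≤ #T · exp(−t²/(2(p Λ₀ + t/3)))`.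

With `Λ₀ = 3m²/32`, `p ≤ 2/m`, `t = m/8`: every non-hub keeps `≥ #A(c) − 5m/16` re-pick rows.
-/

namespace Summit.ValiantsHypothesis.ValiantsHypothesis.Theorems.DefinabilityGapBlockedRows

open Finset Real Literature.Probability.Moments
open Literature.Computability.AlgebraicComplexity Literature.Computability.MetaComplexity
open Summit.ValiantsHypothesis.ValiantsHypothesis.Theorems.DefinabilityGapAffineRung
open Summit.ValiantsHypothesis.ValiantsHypothesis.Theorems.DefinabilityGapPivotCertificate
open Summit.ValiantsHypothesis.ValiantsHypothesis.Theorems.DefinabilityGapPivotAdmissible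
open Summit.ValiantsHypothesis.ValiantsHypothesis.Theorems.DefinabilityGapCrowdedFree
open Summit.ValiantsHypothesis.ValiantsHypothesis.Theorems.DefinabilityGapPivotColumn
open Summit.ValiantsHypothesis.ValiantsHypothesis.Theorems.DefinabilityGapPivotRandom
open Summit.ValiantsHypothesis.ValiantsHypothesis.Theorems.DefinabilityGapPivotPhaseA

variable {m : ℕ}

/-- **Dictionary**: the blocked rows of `c` number at most the column-`s₀` kill sum
`Σ_{c'} colKill T c s₀ c' (r c')`. [this file] -/
theorem card_blockedRows_le_sum_colKill (T : Finset (Fin 3 → Fin (qOf m)))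
    (c : Fin 3 → Fin (qOf m)) (r : (Fin 3 → Fin (qOf m)) → Fin m) (s₀ : Fin m) :
    ((blockedRows T c r s₀).card : ℝ) ≤
      ∑ c' : Fin 3 → Fin (qOf m), colKill T c s₀ c' (r c') := by
  classical
  set R := (Finset.univ : Finset (Fin 3 → Fin (qOf m))).filter
    fun c' => c' ∈ T ∧ c' ≠ c ∧ cellEmb m c' (r c', s₀) = cellEmb m c (r c', s₀) with hR
  have hcard : (blockedRows T c r s₀).card ≤ R.card := by
    have key : ∀ i ∈ blockedRows T c r s₀, ∃ c' ∈ R, r c' = i := by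
      intro i hi
      obtain ⟨c', hc', hrc'⟩ := mem_blockedRows.mp hi
      obtain ⟨hc'T, hc'c, heq⟩ := mem_coCurves.mp hc'
      refine ⟨c', Finset.mem_filter.mpr ⟨Finset.mem_univ _, hc'T, hc'c, ?_⟩, hrc'⟩
      rw [hrc']
      exact heq
    calc (blockedRows T c r s₀).card ≤ (R.image r).card := Finset.card_le_card fun i hi => by
            obtain ⟨c', hc', hrc'⟩ := key i hi
            exact Finset.mem_image.mpr ⟨c', hc', hrc'⟩
      _ ≤ R.card := Finset.card_image_le
  have h2 : (R.card : ℝ) = ∑ c' : Fin 3 → Fin (qOf m), colKill T c s₀ c' (r c') := by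
    rw [hR, Finset.card_filter, Nat.cast_sum]
    refine Finset.sum_congr rfl fun c' _ => ?_
    unfold colKill
    split_ifs <;> simp
  calc ((blockedRows T c r s₀).card : ℝ) ≤ (R.card : ℝ) := by exact_mod_cast hcard
    _ = _ := h2

/-- The column-`s₀` incidence sum is the column load. [this file] -/
theorem sum_card_coCurves_eq_colLoad (T : Finset (Fin 3 → Fin (qOf m)))
    (c : Fin 3 → Fin (qOf m)) (s₀ : Fin m) :
    ∑ a : Fin m, ((coCurves T c (a, s₀)).card : ℝ) = (colLoad T c s₀ : ℝ) := by
  unfold colLoad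
  push_cast
  rfl

/-- **FEW BLOCKED ROWS (Bernstein).**  Under a product law with marginals `≤ p`, if
`colLoad T c s₀ ≤ Λ₀` (`Λ₀ > 0`) then `W{p Λ₀ + t ≤ #blockedRows T c r s₀} ≤
exp(−t²/(2(p Λ₀ + t/3)))`. [this file] -/
theorem weight_manyBlocked_le {w : (Fin 3 → Fin (qOf m)) → Fin m → ℝ}
    (hw : ∀ c a, 0 ≤ w c a) (hw1 : ∀ c, ∑ a, w c a = 1) {p : ℝ} (hp : 0 < p)
    (hwp : ∀ c', w c' ≤ fun _ => p) (T : Finset (Fin 3 → Fin (qOf m)))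
    (c : Fin 3 → Fin (qOf m)) (s₀ : Fin m) {Λ₀ t : ℝ} (hΛ₀ : 0 < Λ₀)
    (hL : (colLoad T c s₀ : ℝ) ≤ Λ₀) (ht : 0 < t) :
    ∑ r ∈ (Finset.univ : Finset ((Fin 3 → Fin (qOf m)) → Fin m)).filter
        (fun r => p * Λ₀ + t ≤ ((blockedRows T c r s₀).card : ℝ)), prodWeight w r
      ≤ exp (-(t ^ 2 / (2 * (p * Λ₀ + 1 * t / 3)))) := by
  classical
  have hmean : ∑ c' : Fin 3 → Fin (qOf m), ∑ a : Fin m, w c' a * colKill T c s₀ c' a ≤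
      p * Λ₀ := by
    refine (mean_colKill_le hp.le hwp T c s₀).trans ?_
    rw [sum_card_coCurves_eq_colLoad]
    exact mul_le_mul_of_nonneg_left hL hp.le
  have hsq : ∑ c' : Fin 3 → Fin (qOf m), ∑ a : Fin m, w c' a * colKill T c s₀ c' a ^ 2 ≤
      p * Λ₀ := (sum_sq_colKill_le w hw T c s₀).trans hmean
  refine le_trans (Finset.sum_le_sum_of_subset_of_nonneg ?_ fun r _ _ => prodWeight_nonneg hw r)
    (weight_colOverload_le hw hw1 T c s₀ hmean (mul_pos hp hΛ₀) hsq ht)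
  intro r hr
  rw [Finset.mem_filter] at hr ⊢
  exact ⟨Finset.mem_univ _, hr.2.trans (card_blockedRows_le_sum_colKill T c r s₀)⟩

/-- **Union over the non-hubs**: the assignments giving `≥ p Λ₀ + t` blocked rows to some curve
of `T` with `colLoad ≤ Λ₀` weigh at most `#T · exp(−t²/(2(p Λ₀ + t/3)))`. [this file] -/
theorem weight_exists_manyBlocked_le {w : (Fin 3 → Fin (qOf m)) → Fin m → ℝ}
    (hw : ∀ c a, 0 ≤ w c a) (hw1 : ∀ c, ∑ a, w c a = 1) {p : ℝ} (hp : 0 < p)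
    (hwp : ∀ c', w c' ≤ fun _ => p) (T : Finset (Fin 3 → Fin (qOf m))) (s₀ : Fin m)
    {Λ₀ t : ℝ} (hΛ₀ : 0 < Λ₀) (ht : 0 < t) :
    ∑ r ∈ (Finset.univ : Finset ((Fin 3 → Fin (qOf m)) → Fin m)).filter
        (fun r => ∃ c ∈ T, (colLoad T c s₀ : ℝ) ≤ Λ₀ ∧
          p * Λ₀ + t ≤ ((blockedRows T c r s₀).card : ℝ)), prodWeight w r
      ≤ (T.card : ℝ) * exp (-(t ^ 2 / (2 * (p * Λ₀ + 1 * t / 3)))) := by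
  classical
  set B : (Fin 3 → Fin (qOf m)) → Finset ((Fin 3 → Fin (qOf m)) → Fin m) :=
    fun c => Finset.univ.filter fun r => (colLoad T c s₀ : ℝ) ≤ Λ₀ ∧
      p * Λ₀ + t ≤ ((blockedRows T c r s₀).card : ℝ) with hB
  have hsub : (Finset.univ : Finset ((Fin 3 → Fin (qOf m)) → Fin m)).filter
      (fun r => ∃ c ∈ T, (colLoad T c s₀ : ℝ) ≤ Λ₀ ∧
        p * Λ₀ + t ≤ ((blockedRows T c r s₀).card : ℝ)) ⊆ T.biUnion B := by
    intro r hr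
    obtain ⟨c, hc, hcL⟩ := (Finset.mem_filter.mp hr).2
    exact Finset.mem_biUnion.mpr ⟨c, hc, Finset.mem_filter.mpr ⟨Finset.mem_univ _, hcL⟩⟩
  have h3 : ∀ c ∈ T, ∑ r ∈ B c, prodWeight w r ≤
      exp (-(t ^ 2 / (2 * (p * Λ₀ + 1 * t / 3)))) := by
    intro c _
    by_cases hL : (colLoad T c s₀ : ℝ) ≤ Λ₀
    · refine le_trans (Finset.sum_le_sum_of_subset_of_nonneg ?_
        fun r _ _ => prodWeight_nonneg hw r)
        (weight_manyBlocked_le hw hw1 hp hwp T c s₀ hΛ₀ hL ht)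
      intro r hr
      rw [hB, Finset.mem_filter] at hr
      exact Finset.mem_filter.mpr ⟨Finset.mem_univ _, hr.2.2⟩
    · have hempty : B c = ∅ := by
        rw [hB]
        exact Finset.filter_eq_empty_iff.mpr fun r _ h => hL h.1
      rw [hempty, Finset.sum_empty]
      exact (exp_pos _).le
  calc _ ≤ ∑ r ∈ T.biUnion B, prodWeight w r :=
        Finset.sum_le_sum_of_subset_of_nonneg hsub fun r _ _ => prodWeight_nonneg hw r
    _ ≤ ∑ c ∈ T, ∑ r ∈ B c, prodWeight w r := weight_biUnion_le _ B hw
    _ ≤ ∑ _c ∈ T, exp (-(t ^ 2 / (2 * (p * Λ₀ + 1 * t / 3)))) := Finset.sum_le_sum h3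
    _ = (T.card : ℝ) * exp (-(t ^ 2 / (2 * (p * Λ₀ + 1 * t / 3)))) := by
        rw [Finset.sum_const, nsmul_eq_mul]

end Summit.ValiantsHypothesis.ValiantsHypothesis.Theorems.DefinabilityGapBlockedRows
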